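/-
Copyright: the b2b-balaban T⁴-continuum CRUX team, row NE7b OWNER lineage `t4-ne7b-p1` (gen 129). Project licence.
-/
import Summits.QuantumFields.BalabanUV.T4Continuum.Spine.NE7b.SupRoadFactorRegulated
import Mathlib.MeasureTheory.Measure.Tilted

/-!
# THREE BRICKS FOR THE SIZE OF THE EFFECTIVE ACTION'S GRADIENT: (i) the road's cell factor is regulated as soon as the remainders are
# STABLE and SUP-SMALL on small fields (`|w_x(t)| ≤ b` for `|t| ≤ h` — (290) asked cubic smallness, but its proof uses only the sup
# bound `c₃vh³`); (ii) the GIBBS inequality for a tilted mean, `⟨F⟩_{e^{−V}μ∕Z} ≤ log ∫e^{−V+F}dμ − log ∫e^{−V}dμ` (Jensen for the tilted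
# probability measure); (iii) the ONE-SITE PERTURBATION `w̃_x = w_x − s·1_{x=y}·w'_y` of a remainder family with `|w'_x(t)| ≤ c₂t²`: it is
# measurable, stable with `κ₀ + |s|c₂`, sup-small with `c₃h³ + |s|c₂h²`, and shifts the exponent by exactly `−s·w'_y(ω_y+ψ_y)` — so the tilted
# mean of `±w'_y`, i.e. the `y`-partial derivative of the step's effective action ((313)), is a difference of two logarithms of ROAD-SHAPED
# small-field integrals, which (311)'s locality bounds by `O(ε)` ((315) assembles) (row NE7b, node U5c; (290) re-read, Mathlib's
# `Measure.tilted` + `ConvexOn.map_integral_le` BY NAME; [folklore])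

Cell `pub-balaban`, sub-cell `t4`, spine estimate NE7b (`T4WeightBudget.RelWeightBound`; the cell's OWN estimate — NOT PRINTED in
[Bałaban 1983–89], NOT PROVED).  Crux-route work under `Spine/NE7b/` by the row OWNER (`t4-ne7b-p1` gen 129, file (314)) under FREEZE
(0)'s crux-prover clause, on § [NE7bP1-G128-HANDOFF] NEXT (3)(c) (the Taylor structure of the next potential: its FIRST coefficient is
`O(ε)`); NOTHING of Bałaban's is named as a Lean object, valued or asserted; no `T4Continuum/Support` leaf typed; no `def`, no notation;
zero `sorry`.  Imports (BY NAME): the OWNER's (290) `…SupRoadFactorRegulated` (`abs_exp_sub_one_le`, `abs_sub_one_le_add_one`, `sq_le_sum_sq`);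
Mathlib's `MeasureTheory.Measure.tilted` (`integral_tilted`, `integral_exp_tilted`, `integrable_tilted_iff`, `isProbabilityMeasure_tilted`),
`ConvexOn.map_integral_le`, `convexOn_exp`, `Real.log_div`, `Finset.sum_ite_eq'`.

WHY (located).  (313) identified the gradient of the step's effective action with the tilted mean of `Σ w'_x(ω_x+ψ_x)dψ_x`; its SIZE is
what decides whether the next potential is again close to its quadratic part.  The Gibbs inequality converts a tilted mean into a
difference of free energies of two integrands of the SAME shape (the remainder at one site perturbed by `∓s·w'_y`), and (311)'s locality makes
that difference `O(ε)` provided the perturbed family is still in the regulated class — which is brick (i) with the sup bound, since `s·w'_y`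
is quadratically, not cubically, small.

WHAT IS PROVED ([folklore]):
* §1 **`supSmall_factor_regulated`** (cell `P` of `≤ v` sites, `w_x(t) ≥ −κ₀t²`, `|w_x(t)| ≤ b` for `|t| ≤ h`, `2κ₀ ≤ κ` ⟹
  `|e^{−Σ_{x∈P}w_x(ζ_x)} − 1| ≤ max(e^{vb} − 1, 2e^{−(κ∕2−κ₀)h²})·e^{½κΣ_Pζ²}` for EVERY `ζ`), `supSmall_eps_nonneg`, `supSmall_factor_norm_le`
  (the complexified cell factor in (289)'s format), `cubic_supSmall` (cubic smallness ⟹ sup-smallness with `b = c₃h³`);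
* §2 **`tilted_mean_le_log_sub`** (`μ ≠ 0`; `e^{−V}`, `e^{−V}F`, `e^{−V+F}` integrable ⟹ `(∫e^{−V}F dμ)∕(∫e^{−V}dμ) ≤ log∫e^{−V+F}dμ − log∫e^{−V}dμ`)
  and the two-sided **`abs_tilted_mean_le`** (with `e^{−V−F}` integrable as well: `|⟨F⟩| ≤ max` of the two free-energy differences);
* §3 the one-site perturbation `w̃_x(t) = w_x(t) − s·(if x = y then w'_x(t) else 0)`: `oneSite_measurable`, `oneSite_stable` (`κ₀ + |s|c₂`),
  `oneSite_supSmall` (`c₃h³ + |s|c₂h²`), **`oneSite_cellSum`** (`y ∈ cell p₀`, `p₀ ∈ S`, disjoint cells ⟹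
  `Σ_{p∈S}Σ_{x∈cell p}w̃_x(ω_x+ψ_x) = Σ_{p∈S}Σ_{x∈cell p}w_x(ω_x+ψ_x) − s·w'_y(ω_y+ψ_y)`); §4 toy.

HONEST (what this is NOT).  Bricks only; the assembly with (306)∕(311)∕(313) into «the gradient of the small-field effective action is `O(ε)`
per site» is (315); scalar skeleton ((A3), NC-NE7b-α UNRULED); nothing of Bałaban's asserted.  BY-NAME EFFECT ON THE WALL: NONE.  NE7b NOT
PRINTED ∕ NOT PROVED; spine PROVED 0∕9; rung (B)+1 — the programme's measures remain FINITE-torus statements; NOT the mass gap, NOT Clay.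
HONEST DEPENDENCY: continuum YM on T⁴ ⇐ BetaPertH ∧ nine spine estimates (0∕9 proved); BetaPertH ⇐ (D1) ∧ (D4) ∧ CAP+tail; G-an2-4 gates
asym, D1 and NE2∕3∕4.
-/

set_option autoImplicit false

noncomputable section

namespace Summit.QuantumFields.BalabanUV.T4Continuum.NE7b.SupOneSitePerturbation

open MeasureTheory ProbabilityTheory Finset Real
open scoped BigOperators
open SupRoadFactorRegulated (abs_exp_sub_one_le abs_sub_one_le_add_one sq_le_sum_sq)

variable {ι : Type} {V : Type*}

/-! ## §1. Stable + sup-small on small fields ⟹ regulated -/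

/-- **THE CELL FACTOR IS REGULATED UNDER STABILITY AND SUP-SMALLNESS ON SMALL FIELDS.**  Cell `P` (`#P ≤ v`), remainders with
`w_x(t) ≥ −κ₀t²` (`κ₀ ≥ 0`) and `|w_x(t)| ≤ b` for `|t| ≤ h` (`b, h ≥ 0`), regulator strength `κ ≥ 2κ₀` ⟹ for EVERY field `ζ`:
`|e^{−Σ_{x∈P}w_x(ζ_x)} − 1| ≤ max(e^{vb} − 1, 2e^{−(κ∕2−κ₀)h²})·e^{½κΣ_{x∈P}ζ_x²}` ((290)'s proof, the cubic bound replaced by its sup). [folklore] -/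
theorem supSmall_factor_regulated (P : Finset ι) {v : ℕ} (hv : P.card ≤ v) (w : ι → ℝ → ℝ) {κ₀ b h κ : ℝ} (hκ₀ : 0 ≤ κ₀)
    (hb : 0 ≤ b) (hh : 0 ≤ h) (hstab : ∀ x ∈ P, ∀ t : ℝ, -(κ₀ * t ^ 2) ≤ w x t)
    (hsup : ∀ x ∈ P, ∀ t : ℝ, |t| ≤ h → |w x t| ≤ b) (hκ : 2 * κ₀ ≤ κ) (ζ : ι → ℝ) :
    |exp (-(∑ x ∈ P, w x (ζ x))) - 1| ≤
      max (exp (v * b) - 1) (2 * exp (-((κ / 2 - κ₀) * h ^ 2))) * exp (κ * (∑ x ∈ P, ζ x ^ 2) / 2) := by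
  set S : ℝ := ∑ x ∈ P, ζ x ^ 2 with hS
  set W : ℝ := ∑ x ∈ P, w x (ζ x) with hW
  set ε : ℝ := max (exp (v * b) - 1) (2 * exp (-((κ / 2 - κ₀) * h ^ 2))) with hε
  have hS0 : 0 ≤ S := sum_nonneg fun x _ => sq_nonneg (ζ x)
  have hκ0 : 0 ≤ κ := by linarith
  have hreg1 : 1 ≤ exp (κ * S / 2) := one_le_exp_iff.2 (by positivity)
  have hε0 : 0 ≤ ε := le_trans (by positivity) (le_max_right _ _)
  by_cases hsm : ∀ x ∈ P, |ζ x| ≤ h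
  · have hWabs : |W| ≤ v * b := by
      calc |W| ≤ ∑ x ∈ P, |w x (ζ x)| := abs_sum_le_sum_abs _ _
        _ ≤ ∑ _x ∈ P, b := sum_le_sum fun x hx => hsup x hx (ζ x) (hsm x hx)
        _ = P.card * b := by rw [sum_const, nsmul_eq_mul]
        _ ≤ v * b := mul_le_mul_of_nonneg_right (by exact_mod_cast hv) hb
    calc |exp (-W) - 1| ≤ exp |-W| - 1 := abs_exp_sub_one_le (-W)
      _ ≤ exp (v * b) - 1 := by rw [abs_neg]; linarith [exp_le_exp.2 hWabs]
      _ ≤ ε := le_max_left _ _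
      _ ≤ ε * exp (κ * S / 2) := le_mul_of_one_le_right hε0 hreg1
  · push Not at hsm
    obtain ⟨x, hxP, hxh⟩ := hsm
    have hhS : h ^ 2 ≤ S := by
      have h1 : h ^ 2 ≤ ζ x ^ 2 := by
        rw [← sq_abs (ζ x)]
        exact pow_le_pow_left₀ hh hxh.le 2
      exact h1.trans (sq_le_sum_sq P ζ hxP)
    have hWS : -W ≤ κ₀ * S := by
      rw [hW, hS, mul_sum, ← sum_neg_distrib]
      exact sum_le_sum fun y hy => by linarith [hstab y hy (ζ y)]
    have hmargin : (κ / 2 - κ₀) * h ^ 2 ≤ (κ / 2 - κ₀) * S := mul_le_mul_of_nonneg_left hhS (by linarith)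
    calc |exp (-W) - 1| ≤ exp (-W) + 1 := abs_sub_one_le_add_one (exp_pos _)
      _ ≤ 2 * exp (κ₀ * S) := by
          have h1 : exp (-W) ≤ exp (κ₀ * S) := exp_le_exp.2 hWS
          have h2 : 1 ≤ exp (κ₀ * S) := one_le_exp_iff.2 (by positivity)
          linarith
      _ = 2 * exp (-((κ / 2 - κ₀) * S)) * exp (κ * S / 2) := by
          rw [mul_assoc, ← exp_add]
          congr 2
          ring
      _ ≤ 2 * exp (-((κ / 2 - κ₀) * h ^ 2)) * exp (κ * S / 2) := by
          refine mul_le_mul_of_nonneg_right ?_ (exp_pos _).le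
          exact mul_le_mul_of_nonneg_left (exp_le_exp.2 (neg_le_neg hmargin)) zero_le_two
      _ ≤ ε * exp (κ * S / 2) := mul_le_mul_of_nonneg_right (le_max_right _ _) (exp_pos _).le

/-- The smallness parameter `max(e^{vb} − 1, 2e^{−(κ∕2−κ₀)h²})` is `≥ 0`. [folklore] -/
theorem supSmall_eps_nonneg (v : ℕ) (b h κ κ₀ : ℝ) : 0 ≤ max (exp (v * b) - 1) (2 * exp (-((κ / 2 - κ₀) * h ^ 2))) :=
  le_trans (by positivity) (le_max_right _ _)

/-- **The regulated bound in (289)'s format** for cells `cell p` of `≤ v` sites with stable, sup-small remainders: the complexified road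
factor obeys `‖g_p(ω)‖ ≤ max(e^{vb}−1, 2e^{−(κ∕2−κ₀)h²})·e^{½κΣ_{x∈cell p}ω_x²}`. [folklore] -/
theorem supSmall_factor_norm_le (cell : V → Finset ι) {v : ℕ} (hv : ∀ p, (cell p).card ≤ v) (w : ι → ℝ → ℝ) {κ₀ b h κ : ℝ}
    (hκ₀ : 0 ≤ κ₀) (hb : 0 ≤ b) (hh : 0 ≤ h) (hstab : ∀ x, ∀ t : ℝ, -(κ₀ * t ^ 2) ≤ w x t)
    (hsup : ∀ x, ∀ t : ℝ, |t| ≤ h → |w x t| ≤ b) (hκ : 2 * κ₀ ≤ κ) (p : V) (ω : EuclideanSpace ℝ ι) :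
    ‖(((exp (-(∑ x ∈ cell p, w x (ω x))) - 1 : ℝ)) : ℂ)‖ ≤
      max (exp (v * b) - 1) (2 * exp (-((κ / 2 - κ₀) * h ^ 2))) * exp (κ * (∑ x ∈ cell p, ω x ^ 2) / 2) := by
  rw [Complex.norm_real, Real.norm_eq_abs]
  exact supSmall_factor_regulated (cell p) (hv p) w hκ₀ hb hh (fun x _ t => hstab x t) (fun x _ t ht => hsup x t ht) hκ (fun x => ω x)

/-- **Cubic smallness implies sup-smallness** with `b = c₃h³`. [folklore] -/
theorem cubic_supSmall (w : ι → ℝ → ℝ) {c₃ h : ℝ} (hc₃ : 0 ≤ c₃) (hcub : ∀ x, ∀ t : ℝ, |t| ≤ h → |w x t| ≤ c₃ * |t| ^ 3)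
    (x : ι) (t : ℝ) (ht : |t| ≤ h) : |w x t| ≤ c₃ * h ^ 3 :=
  (hcub x t ht).trans (mul_le_mul_of_nonneg_left (pow_le_pow_left₀ (abs_nonneg t) ht 3) hc₃)

/-! ## §2. The Gibbs inequality for a tilted mean -/

section Gibbs

variable {Ω : Type*} [MeasurableSpace Ω] {μ : Measure Ω} {U F : Ω → ℝ}

/-- **THE GIBBS INEQUALITY**: `μ ≠ 0`; `e^{−U}`, `e^{−U}·F` and `e^{−U+F}` integrable ⟹
`(∫ e^{−U}F dμ)∕(∫ e^{−U} dμ) ≤ log ∫ e^{−U+F} dμ − log ∫ e^{−U} dμ` (Jensen for the tilted probability measure `e^{−U}μ∕Z`). [folklore] -/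
theorem tilted_mean_le_log_sub [NeZero μ] (hU : Integrable (fun ω => exp (-U ω)) μ)
    (hUF : Integrable (fun ω => exp (-U ω) * F ω) μ) (hF : Integrable (fun ω => exp (-U ω + F ω)) μ) :
    (∫ ω, exp (-U ω) * F ω ∂μ) / (∫ ω, exp (-U ω) ∂μ) ≤ log (∫ ω, exp (-U ω + F ω) ∂μ) - log (∫ ω, exp (-U ω) ∂μ) := by
  set ν := μ.tilted (fun ω => -U ω) with hν
  haveI : IsProbabilityMeasure ν := isProbabilityMeasure_tilted hU
  have hZ : 0 < ∫ ω, exp (-U ω) ∂μ := integral_exp_pos hU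
  have hZF : 0 < ∫ ω, exp (-U ω + F ω) ∂μ := integral_exp_pos hF
  -- the tilted mean and the tilted exponential moment
  have hmean : ∫ ω, F ω ∂ν = (∫ ω, exp (-U ω) * F ω ∂μ) / (∫ ω, exp (-U ω) ∂μ) := by
    rw [hν, integral_tilted]
    simp_rw [smul_eq_mul, div_mul_eq_mul_div]
    rw [integral_div]
  have hexpm : ∫ ω, exp (F ω) ∂ν = (∫ ω, exp (-U ω + F ω) ∂μ) / (∫ ω, exp (-U ω) ∂μ) := by
    rw [hν, integral_exp_tilted]
    rfl
  have hFi : Integrable F ν := by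
    rw [hν, integrable_tilted_iff hU]
    simpa only [smul_eq_mul] using hUF
  have hEi : Integrable (fun ω => exp (F ω)) ν := by
    rw [hν, integrable_tilted_iff hU]
    refine hF.congr (ae_of_all _ fun ω => ?_)
    simp only [smul_eq_mul, exp_add]
  -- Jensen
  have hJ := ConvexOn.map_integral_le (μ := ν) (f := F) convexOn_exp continuous_exp.continuousOn isClosed_univ
    (ae_of_all _ fun _ => Set.mem_univ _) hFi hEi
  rw [hmean, hexpm] at hJ
  calc (∫ ω, exp (-U ω) * F ω ∂μ) / (∫ ω, exp (-U ω) ∂μ)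
      = log (exp ((∫ ω, exp (-U ω) * F ω ∂μ) / (∫ ω, exp (-U ω) ∂μ))) := (log_exp _).symm
    _ ≤ log ((∫ ω, exp (-U ω + F ω) ∂μ) / (∫ ω, exp (-U ω) ∂μ)) := log_le_log (exp_pos _) hJ
    _ = log (∫ ω, exp (-U ω + F ω) ∂μ) - log (∫ ω, exp (-U ω) ∂μ) := log_div hZF.ne' hZ.ne'

/-- **THE TWO-SIDED GIBBS BOUND**: with `e^{−U−F}` integrable as well,
`|(∫ e^{−U}F dμ)∕(∫ e^{−U} dμ)| ≤ max(log∫e^{−U+F} − log∫e^{−U}, log∫e^{−U−F} − log∫e^{−U})`. [folklore] -/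
theorem abs_tilted_mean_le [NeZero μ] (hU : Integrable (fun ω => exp (-U ω)) μ)
    (hUF : Integrable (fun ω => exp (-U ω) * F ω) μ) (hF : Integrable (fun ω => exp (-U ω + F ω)) μ)
    (hF' : Integrable (fun ω => exp (-U ω - F ω)) μ) :
    |(∫ ω, exp (-U ω) * F ω ∂μ) / (∫ ω, exp (-U ω) ∂μ)| ≤
      max (log (∫ ω, exp (-U ω + F ω) ∂μ) - log (∫ ω, exp (-U ω) ∂μ))
        (log (∫ ω, exp (-U ω - F ω) ∂μ) - log (∫ ω, exp (-U ω) ∂μ)) := by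
  have hplus := tilted_mean_le_log_sub hU hUF hF
  have hUF' : Integrable (fun ω => exp (-U ω) * (-F ω)) μ := by
    refine hUF.neg.congr (ae_of_all _ fun ω => ?_)
    simp only [Pi.neg_apply, mul_neg]
  have hF'' : Integrable (fun ω => exp (-U ω + -F ω)) μ := hF'.congr (ae_of_all _ fun ω => by simp only [sub_eq_add_neg])
  have hminus := tilted_mean_le_log_sub hU hUF' hF''
  have hneg : (∫ ω, exp (-U ω) * -F ω ∂μ) / (∫ ω, exp (-U ω) ∂μ) = -((∫ ω, exp (-U ω) * F ω ∂μ) / (∫ ω, exp (-U ω) ∂μ)) := by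
    rw [← neg_div, ← integral_neg]
    congr 1
    exact integral_congr_ae (ae_of_all _ fun ω => by simp only [mul_neg])
  rw [hneg] at hminus
  have hint : ∫ ω, exp (-U ω + -F ω) ∂μ = ∫ ω, exp (-U ω - F ω) ∂μ :=
    integral_congr_ae (ae_of_all _ fun ω => by simp only [sub_eq_add_neg])
  rw [hint] at hminus
  rw [abs_le]
  constructor
  · linarith [le_max_right (log (∫ ω, exp (-U ω + F ω) ∂μ) - log (∫ ω, exp (-U ω) ∂μ))
      (log (∫ ω, exp (-U ω - F ω) ∂μ) - log (∫ ω, exp (-U ω) ∂μ))]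
  · exact hplus.trans (le_max_left _ _)

end Gibbs

/-! ## §3. The one-site perturbation of a remainder family -/

section OneSite

variable [DecidableEq ι] (w w' : ι → ℝ → ℝ) (y : ι) (s : ℝ)

/-- The perturbed family is measurable. [folklore] -/
theorem oneSite_measurable (hw : ∀ x, Measurable (w x)) (hw'm : ∀ x, Measurable (w' x)) (x : ι) :
    Measurable fun t => w x t - s * (if x = y then w' x t else 0) := by
  by_cases hxy : x = y
  · simp only [hxy, if_true]; exact (hw y).sub ((hw'm y).const_mul s)
  · simp only [hxy, if_false, mul_zero, sub_zero]; exact hw x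

/-- **Stability of the perturbed family**: `w_x(t) ≥ −κ₀t²`, `|w'_x(t)| ≤ c₂t²` ⟹ `w̃_x(t) ≥ −(κ₀ + |s|c₂)t²`. [folklore] -/
theorem oneSite_stable {κ₀ c₂ : ℝ} (hstab : ∀ x, ∀ t : ℝ, -(κ₀ * t ^ 2) ≤ w x t) (hw'q : ∀ x t, |w' x t| ≤ c₂ * t ^ 2) (x : ι) (t : ℝ) :
    -((κ₀ + |s| * c₂) * t ^ 2) ≤ w x t - s * (if x = y then w' x t else 0) := by
  have h1 := hstab x t
  have h2 : |s * (if x = y then w' x t else 0)| ≤ |s| * c₂ * t ^ 2 := by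
    rw [abs_mul, mul_assoc]
    refine mul_le_mul_of_nonneg_left ?_ (abs_nonneg s)
    split_ifs
    · exact hw'q x t
    · rw [abs_zero]; nlinarith [abs_nonneg (w' x t), hw'q x t]
  have h3 := le_abs_self (s * (if x = y then w' x t else 0))
  nlinarith

/-- **Sup-smallness of the perturbed family on small fields**: `|w_x(t)| ≤ c₃|t|³` and `|w'_x(t)| ≤ c₂t²` for `|t| ≤ h` ⟹
`|w̃_x(t)| ≤ c₃h³ + |s|c₂h²` for `|t| ≤ h`. [folklore] -/
theorem oneSite_supSmall {c₃ c₂ h : ℝ} (hc₃ : 0 ≤ c₃) (hc₂ : 0 ≤ c₂) (hcub : ∀ x, ∀ t : ℝ, |t| ≤ h → |w x t| ≤ c₃ * |t| ^ 3)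
    (hw'q : ∀ x t, |w' x t| ≤ c₂ * t ^ 2) (x : ι) (t : ℝ) (ht : |t| ≤ h) :
    |w x t - s * (if x = y then w' x t else 0)| ≤ c₃ * h ^ 3 + |s| * c₂ * h ^ 2 := by
  have hh : 0 ≤ h := (abs_nonneg t).trans ht
  have h1 : |w x t| ≤ c₃ * h ^ 3 := cubic_supSmall w hc₃ hcub x t ht
  have ht2 : t ^ 2 ≤ h ^ 2 := by rw [← sq_abs t]; exact pow_le_pow_left₀ (abs_nonneg t) ht 2
  have h2 : |s * (if x = y then w' x t else 0)| ≤ |s| * c₂ * h ^ 2 := by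
    rw [abs_mul, mul_assoc]
    refine mul_le_mul_of_nonneg_left ?_ (abs_nonneg s)
    split_ifs
    · exact (hw'q x t).trans (mul_le_mul_of_nonneg_left ht2 hc₂)
    · rw [abs_zero]; positivity
  exact (abs_sub _ _).trans (add_le_add h1 h2)

/-- **THE PERTURBATION SHIFTS THE EXPONENT BY EXACTLY `−s·w'_y(ω_y+ψ_y)`**: `y ∈ cell p₀`, `p₀ ∈ S`, pairwise disjoint cells ⟹
`Σ_{p∈S}Σ_{x∈cell p}w̃_x(ω_x+ψ_x) = Σ_{p∈S}Σ_{x∈cell p}w_x(ω_x+ψ_x) − s·w'_y(ω_y+ψ_y)`. [folklore] -/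
theorem oneSite_cellSum [DecidableEq V] (cell : V → Finset ι) (hdisj : ∀ p q, p ≠ q → Disjoint (cell p) (cell q)) (S : Finset V)
    {p₀ : V} (hp₀ : p₀ ∈ S) (hy : y ∈ cell p₀) (ω ψ : ι → ℝ) :
    ∑ p ∈ S, ∑ x ∈ cell p, (w x (ω x + ψ x) - s * (if x = y then w' x (ω x + ψ x) else 0)) =
      ∑ p ∈ S, ∑ x ∈ cell p, w x (ω x + ψ x) - s * w' y (ω y + ψ y) := by
  have hpd : (S : Set V).PairwiseDisjoint cell := fun p _ q _ hpq => hdisj p q hpq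
  have hyU : y ∈ S.biUnion cell := mem_biUnion.2 ⟨p₀, hp₀, hy⟩
  simp only [sum_sub_distrib]
  congr 1
  rw [← sum_biUnion hpd, ← mul_sum, sum_ite_eq' (S.biUnion cell) y (fun x => w' x (ω x + ψ x)), if_pos hyU]

end OneSite

/-! ## §4. Toy -/

/-- Toy (§1): the ZERO remainder on a one-site cell is sup-small with `b = 0` and stable with `κ₀ = 0`: `|e^0 − 1| ≤ ε·e^{½κζ²}`. -/
example (ζ : Fin 1 → ℝ) :
    |exp (-(∑ x ∈ (Finset.univ : Finset (Fin 1)), (fun (_ : Fin 1) (_ : ℝ) => (0 : ℝ)) x (ζ x))) - 1| ≤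
      max (exp ((1 : ℕ) * (0 : ℝ)) - 1) (2 * exp (-(((2 : ℝ) / 2 - 0) * (1 : ℝ) ^ 2))) *
        exp ((2 : ℝ) * (∑ x ∈ (Finset.univ : Finset (Fin 1)), ζ x ^ 2) / 2) :=
  supSmall_factor_regulated (κ₀ := 0) (b := 0) (h := 1) (κ := 2) (v := 1) Finset.univ (by simp)
    (fun (_ : Fin 1) (_ : ℝ) => (0 : ℝ)) le_rfl le_rfl zero_le_one
    (fun x _ t => show -(0 * t ^ 2) ≤ (0 : ℝ) by simp)
    (fun x _ t _ => show |(0 : ℝ)| ≤ 0 by rw [abs_zero]) (by norm_num) ζ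

end Summit.QuantumFields.BalabanUV.T4Continuum.NE7b.SupOneSitePerturbation
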